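import Literature.NumberTheory.GaussSums.MatthewsQuarticSign
import Literature.NumberTheory.EllipticCurves.CongruentNumberCurveJacobiSums
import Literature.NumberTheory.EllipticCurves.HalfIntegralWeightFormsGaussSumProofs
import Literature.NumberTheory.LFunctions.KloostermanPrimePower
import HarnessLib

/-!
# Matthews' quartic Gauss sum — the algebraic half (Ireland–Rosen Prop. 9.10.1)

Work towards `Literature.NumberTheory.GaussSums.matthews1979_quarticGaussSum_sign`
(Matthews 1979; Ireland–Rosen p. 138), in the ELEMENTARY DRESS of that fact: `p ≡ 1 (mod 4)` prime,
`a² + b² = p` with `π = a + bi` primary, `r = -a/b ∈ ZMod p` (the image of `i` under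
`ℤ[i] → ℤ[i]/(π) = ZMod p`), and `χ` the quartic residue character written as the `if`-cascade on
`x^{(p-1)/4} ∈ {1, r, -1, -r}` with complex values.

Everything here is proved, by REUSING the tree's Gaussian-integer development of the quartic
residue character `χ_π` (`Literature.NumberTheory.EllipticCurves.GaussianQuartic`, file
`CongruentNumberCurveJacobiSums`: `chi`, `chiC`, `iota`, Ireland–Rosen Props. 9.9.1–9.9.4
`neg_mul_jacobiSum_eq : -χ_π(-1) J(χ_π, χ_π) = π`) and the tree's evaluation of the quadratic
Gauss sum (`ModularForms.legendreGaussSum_eq`, IR Ch. 6 Thm 1):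

* `cascade_eq_chiC` — the fact's cascade IS `χ_π` (with `π = ⟨a, b⟩`, `ι = r = -a/b`) viewed in `ℂ`;
* `quarticGaussSum_eq_gaussSum` — the fact's sum is Mathlib's `gaussSum χ_π ψ_p`;
* `gaussSum_chiC_sq` — `g(χ_π)² = √p · J(χ_π, χ_π)` (IR Ch. 8 Thm 1 + Ch. 6 Thm 1);
* `jacobiSum_chiC_eq` — `J(χ_π, χ_π) = -(-1)^{(p-1)/4} (a + bi)` in `ℂ` (IR Prop. 9.9.4);
* **`quarticGaussSum_sq`** — IR Prop. 9.10.1 in the binders of the fact: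
  `(Σ_{x<p} χ(x) e^{2πix/p})² = -(-1)^{(p-1)/4} (a + bi) √p`;
* **`quarticGaussSum_eq_or`** — hence `g(χ) = i√R` or `g(χ) = -i√R`, `R = (-1)^{(p-1)/4} π √p`
  with the principal root `R^{1/2}` of the fact: Matthews' theorem is exactly the statement of
  WHICH sign holds (`ε = -β χ_π(2i) (2|b|/a) ∈ {i, -i}`); that bit (Matthews 1979, elliptic
  functions + modular forms, Invent. Math. 54, 23–52) is NOT proved here;
* **`quarticGaussSum_eq_matthews_or_neg`** — with `RHS` literally the fact's right-hand side,
  `ε² = β² χ(2r)² (2|b|/|a|)² = -1` (`cascade_two_mul_r_sq`: `2r = (1+r)²`; the Jacobi symbol is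
  `±1` as `gcd(2|b|, |a|) = 1`), so `LHS = RHS ∨ LHS = -RHS` for every admissible `(p, a, b)`.

(The display `g(χ_π)² = (-1)^{(p-1)/4} π √p` on IR p. 138 omits the minus sign of Prop. 9.10.1,
p. 134; the final formula for `ε` is consistent with Prop. 9.10.1 since `ε² = -1`.)

## References

* [IrelandRosen1990] K. Ireland, M. Rosen, *A Classical Introduction to Modern Number Theory*,
  GTM 84: Ch. 8 §3 Thm 1; Ch. 9 §9 Props. 9.9.1–9.9.4 (PDF pp. 130–131); Ch. 9 §10 Prop. 9.10.1
  (PDF p. 134); p. 138 (Matthews' formula) — held copy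
  `book:ireland1982-classical-introduction-modern-number-theory`, read 2026-08-15.
* [Matthews1979Quartic] C. R. Matthews, *Gauss sums and elliptic functions II. The quartic sum*,
  Invent. Math. 54 (1979) 23–52.
* [BerndtEvans1981] B. C. Berndt, R. J. Evans, *The determination of Gauss sums*,
  Bull. AMS (N.S.) 5 (1981) 107–129, §4.1.
-/

noncomputable section

open Complex Finset

namespace Literature.NumberTheory.GaussSums

namespace MatthewsQuartic

open Literature.NumberTheory.EllipticCurves.GaussianQuartic
open Literature.NumberTheory.EllipticCurves.ModularForms
open Literature.NumberTheory.QuadraticFields.GaussianPrimary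

local notation "ℤ[i]" => GaussianInt

variable {p : ℕ} [hp : Fact p.Prime] {a b : ℤ}

/-! ## The data of the fact as a Gaussian prime `π = ⟨a, b⟩` -/

omit hp in
/-- `N(a + bi) = a² + b² = p`. [folklore] -/
theorem norm_mk (hab : a ^ 2 + b ^ 2 = (p : ℤ)) : (⟨a, b⟩ : ℤ[i]).norm = p := by
  rw [Zsqrtd.norm_def]
  linear_combination hab

/-- `ι(⟨a, b⟩) = -a/b`: the tree's `iota` is the `r` of the fact. [folklore] -/
theorem iota_mk : iota (p := p) (⟨a, b⟩ : ℤ[i]) = -(a : ZMod p) * (b : ZMod p)⁻¹ := rfl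

omit hp in
/-- The fact's primary condition is the tree's `IsPrimary ⟨a, b⟩`. [folklore] -/
theorem isPrimary_mk (hprim : (a % 4 = 1 ∧ b % 4 = 0) ∨ (a % 4 = 3 ∧ b % 4 = 2)) :
    IsPrimary (⟨a, b⟩ : ℤ[i]) := hprim

omit hp in
/-- `(p - 1)/4 = p/4` for `p ≡ 1 (mod 4)`. [folklore] -/
theorem sub_one_div_four (hp1 : p % 4 = 1) : (p - 1) / 4 = p / 4 := by omega

/-- **The cascade of the fact is `χ_π` in `ℂ`** (`π = ⟨a, b⟩`, `ι = -a/b`): both are "the `i^k`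
with `x^{(p-1)/4} = ι^k`", the tree's `chiFun` being the same cascade with values in `ℤ[i]`.
[cite: IrelandRosen1990, Ch. 9 §8 Definition of the quartic residue character (PDF p. 129)] -/
theorem cascade_eq_chiC (hp1 : p % 4 = 1) (hab : a ^ 2 + b ^ 2 = (p : ℤ)) (x : ZMod p) :
    (if x = 0 then 0 else if x ^ ((p - 1) / 4) = 1 then 1
      else if x ^ ((p - 1) / 4) = -(a : ZMod p) * (b : ZMod p)⁻¹ then Complex.I
      else if x ^ ((p - 1) / 4) = -1 then -1 else -Complex.I) =
      chiC hp1 (norm_mk hab) x := by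
  rw [chiC_apply, chi_apply, chiFun, iota_mk, sub_one_div_four hp1]
  split_ifs <;> simp [GaussianInt.toComplex_def']

/-- The Gauss sum of the fact is Mathlib's `gaussSum χ_π ψ_p`, `ψ_p(x) = e^{2πi x/p}`. [folklore] -/
theorem quarticGaussSum_eq_gaussSum (hp1 : p % 4 = 1) (hab : a ^ 2 + b ^ 2 = (p : ℤ)) :
    ∑ x ∈ Finset.range p, (if (x : ZMod p) = 0 then 0 else if (x : ZMod p) ^ ((p - 1) / 4) = 1 then 1
      else if (x : ZMod p) ^ ((p - 1) / 4) = -(a : ZMod p) * (b : ZMod p)⁻¹ then Complex.I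
      else if (x : ZMod p) ^ ((p - 1) / 4) = -1 then -1 else -Complex.I) *
        Complex.exp (2 * Real.pi * Complex.I * (x : ℂ) / (p : ℂ)) =
      gaussSum (chiC hp1 (norm_mk hab)) (ZMod.stdAddChar (N := p)) := by
  rw [gaussSum, Literature.NumberTheory.LFunctions.sum_zmod_eq_sum_range]
  refine sum_congr rfl fun x _ => ?_
  rw [cascade_eq_chiC hp1 hab]
  congr 1
  have := ZMod.stdAddChar_coe (N := p) (x : ℤ)
  push_cast at this
  rw [this]

/-- The tree's `ρ` in `ℂ` is the tree's `quadCharC` (both are `(·/p)` cast to `ℂ`). [folklore] -/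
theorem rhoC_eq_quadCharC : rhoC p = quadCharC p := by
  refine MulChar.ext' fun t => ?_
  rw [rhoC_apply, rho_apply, quadCharC_apply, map_intCast]

/-- **`g(χ_π)² = √p · J(χ_π, χ_π)`**: Mathlib's `g(χ)² = g(χ²) J(χ,χ)` (IR Ch. 8 Thm 1) and the
quadratic Gauss sum `g((·/p)) = √p` for `p ≡ 1 (mod 4)` (IR Ch. 6 Thm 1, the tree's
`legendreGaussSum_eq`). [cite: IrelandRosen1990, Ch. 8 §3 Thm 1; Ch. 6 §4 Thm 1] -/
theorem gaussSum_chiC_sq (hp1 : p % 4 = 1) {π : ℤ[i]} (hπp : π.norm = p) :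
    gaussSum (chiC hp1 hπp) (ZMod.stdAddChar (N := p)) ^ 2 =
      (Real.sqrt p : ℂ) * jacobiSum (chiC hp1 hπp) (chiC hp1 hπp) := by
  have h := jacobiSum_mul_nontrivial (chiC_ne_one hp1 hπp).2.1 (ZMod.stdAddChar (N := p))
  rw [chiC_sq hp1 hπp, rhoC_eq_quadCharC] at h
  have hg : gaussSum (quadCharC p) (ZMod.stdAddChar (N := p)) = (Real.sqrt p : ℂ) := by
    have := legendreGaussSum_eq (p := p) (by rintro rfl; norm_num at hp1)
    rw [legendreGaussSum] at this
    rw [this, thetaEps]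
    have h4 : ¬ ((p : ℤ) % 4 = 3) := by omega
    rw [if_neg h4, one_mul]
  rw [hg] at h
  rw [sq, ← h]

/-- `χ_π(-1) = (-1)^{(p-1)/4}` in `ℤ[i]`. [cite: IrelandRosen1990, Ch. 9 §10, proof of Prop. 9.10.1] -/
theorem chi_neg_one_eq (hp1 : p % 4 = 1) {π : ℤ[i]} (hπp : π.norm = p) :
    chi hp1 hπp (-1) = (-1) ^ (p / 4) := by
  refine (chi_eq_iff hp1 hπp (neg_ne_zero.mpr one_ne_zero) (isUnit_one.neg.pow _)).mpr ?_
  rw [map_pow, map_neg, map_one]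

/-- **`J(χ_π, χ_π) = -(-1)^{(p-1)/4} π`** in `ℤ[i]` for `π` primary (IR Prop. 9.9.4 with
`χ_π(-1) = (-1)^{(p-1)/4}`). [cite: IrelandRosen1990, Ch. 9 §9 Prop. 9.9.4 (PDF p. 131)] -/
theorem jacobiSum_chi_eq (hp1 : p % 4 = 1) {π : ℤ[i]} (hπp : π.norm = p) (hπ : IsPrimary π) :
    jacobiSum (chi hp1 hπp) (chi hp1 hπp) = -(-1) ^ (p / 4) * π := by
  have hJ := neg_mul_jacobiSum_eq hp1 hπp hπ
  rw [chi_neg_one_eq hp1 hπp] at hJ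
  have hc2 : ((-1 : ℤ[i]) ^ (p / 4)) * ((-1 : ℤ[i]) ^ (p / 4)) = 1 := by
    rw [← mul_pow, neg_one_mul, neg_neg, one_pow]
  set c : ℤ[i] := (-1) ^ (p / 4)
  set J := jacobiSum (chi hp1 hπp) (chi hp1 hπp)
  linear_combination (-c) * hJ - J * hc2

/-- **`J(χ_π, χ_π) = -(-1)^{(p-1)/4} (a + bi)`** in `ℂ`, `π = a + bi` primary.
[cite: IrelandRosen1990, Ch. 9 §9 Prop. 9.9.4 (PDF p. 131)] -/
theorem jacobiSum_chiC_eq (hp1 : p % 4 = 1) (hab : a ^ 2 + b ^ 2 = (p : ℤ))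
    (hprim : (a % 4 = 1 ∧ b % 4 = 0) ∨ (a % 4 = 3 ∧ b % 4 = 2)) :
    jacobiSum (chiC hp1 (norm_mk hab)) (chiC hp1 (norm_mk hab)) =
      -(-1) ^ ((p - 1) / 4) * ((a : ℂ) + (b : ℂ) * I) := by
  have hJ := jacobiSum_chi_eq hp1 (norm_mk hab) (isPrimary_mk hprim)
  have hC := jacobiSum_ringHomComp (chi hp1 (norm_mk hab)) (chi hp1 (norm_mk hab))
    GaussianInt.toComplex
  change jacobiSum (chiC hp1 (norm_mk hab)) (chiC hp1 (norm_mk hab)) = _ at hC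
  rw [hC, hJ, map_mul, map_neg, map_pow, map_neg, map_one, GaussianInt.toComplex_def',
    sub_one_div_four hp1]

end MatthewsQuartic

/-! ## IR Prop. 9.10.1 in the dress of the fact, and the reduction of Matthews' theorem to a sign -/

section PropNineTenOne

/-- **Ireland–Rosen Prop. 9.10.1** in the elementary dress of `matthews1979_quarticGaussSum_sign`
(same binders as the fact): for `p ≡ 1 (mod 4)` prime, `a² + b² = p` with `a + bi` primary,
`r = -a/b` and `χ` the quartic-residue cascade,
`(Σ_{x<p} χ(x) e^{2πix/p})² = -(-1)^{(p-1)/4} · (a + bi) · √p`.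
(The display on IR p. 138 omits the leading minus sign; Prop. 9.10.1 on p. 134 has it.)
[cite: IrelandRosen1990, Ch. 9 §10 Prop. 9.10.1 (PDF p. 134)] -/
theorem quarticGaussSum_sq (p : ℕ) (a b : ℤ) (r : ZMod p) (χ : ZMod p → ℂ) (hp : p.Prime)
    (hp1 : p % 4 = 1) (hab : a ^ 2 + b ^ 2 = (p : ℤ))
    (hprim : (a % 4 = 1 ∧ b % 4 = 0) ∨ (a % 4 = 3 ∧ b % 4 = 2))
    (hr : r = -(a : ZMod p) * (b : ZMod p)⁻¹)
    (hχ : χ = fun x => if x = 0 then 0 else if x ^ ((p - 1) / 4) = 1 then 1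
      else if x ^ ((p - 1) / 4) = r then Complex.I else if x ^ ((p - 1) / 4) = -1 then -1
      else -Complex.I) :
    (∑ x ∈ Finset.range p, χ (x : ZMod p) *
        Complex.exp (2 * Real.pi * Complex.I * (x : ℂ) / (p : ℂ))) ^ 2 =
      -(-1 : ℂ) ^ ((p - 1) / 4) * ((a : ℂ) + (b : ℂ) * Complex.I) * ((Real.sqrt p : ℝ) : ℂ) := by
  haveI : Fact p.Prime := ⟨hp⟩
  subst hχ hr
  rw [MatthewsQuartic.quarticGaussSum_eq_gaussSum hp1 hab, MatthewsQuartic.gaussSum_chiC_sq hp1,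
    MatthewsQuartic.jacobiSum_chiC_eq hp1 hab hprim]
  ring

/-- **Matthews' theorem is a one-bit statement.** With `R = (-1)^{(p-1)/4} (a + bi) √p` and the
principal square root `√R = R^{1/2}` (as in the fact), Prop. 9.10.1 gives `g(χ)² = -R = (i√R)²`,
hence `g(χ) = i √R` or `g(χ) = -i √R`; Matthews' `ε = -β χ_π(2i) (2|b|/a) ∈ {i, -i}` says which.
[cite: IrelandRosen1990, Ch. 9 p. 138] -/
theorem quarticGaussSum_eq_or (p : ℕ) (a b : ℤ) (r : ZMod p) (χ : ZMod p → ℂ) (hp : p.Prime)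
    (hp1 : p % 4 = 1) (hab : a ^ 2 + b ^ 2 = (p : ℤ))
    (hprim : (a % 4 = 1 ∧ b % 4 = 0) ∨ (a % 4 = 3 ∧ b % 4 = 2))
    (hr : r = -(a : ZMod p) * (b : ZMod p)⁻¹)
    (hχ : χ = fun x => if x = 0 then 0 else if x ^ ((p - 1) / 4) = 1 then 1
      else if x ^ ((p - 1) / 4) = r then Complex.I else if x ^ ((p - 1) / 4) = -1 then -1
      else -Complex.I) :
    (∑ x ∈ Finset.range p, χ (x : ZMod p) *
        Complex.exp (2 * Real.pi * Complex.I * (x : ℂ) / (p : ℂ)) =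
      Complex.I * ((-1 : ℂ) ^ ((p - 1) / 4) * ((a : ℂ) + (b : ℂ) * Complex.I) *
        ((Real.sqrt p : ℝ) : ℂ)) ^ ((1 : ℂ) / 2)) ∨
    (∑ x ∈ Finset.range p, χ (x : ZMod p) *
        Complex.exp (2 * Real.pi * Complex.I * (x : ℂ) / (p : ℂ)) =
      -(Complex.I * ((-1 : ℂ) ^ ((p - 1) / 4) * ((a : ℂ) + (b : ℂ) * Complex.I) *
        ((Real.sqrt p : ℝ) : ℂ)) ^ ((1 : ℂ) / 2))) := by
  have hsq := quarticGaussSum_sq p a b r χ hp hp1 hab hprim hr hχ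
  set R : ℂ := (-1 : ℂ) ^ ((p - 1) / 4) * ((a : ℂ) + (b : ℂ) * Complex.I) * ((Real.sqrt p : ℝ) : ℂ)
    with hR
  have hroot : (R ^ ((1 : ℂ) / 2)) ^ 2 = R := by
    rw [one_div]
    exact Complex.cpow_nat_inv_pow R two_ne_zero
  rw [← sq_eq_sq_iff_eq_or_eq_neg, hsq, mul_pow, hroot, Complex.I_sq]
  ring

end PropNineTenOne


/-! ## Matthews' right-hand side squares to `-R`: the fact holds up to one global sign

The three unit factors of Matthews' `ε = -β χ_π(2i) (2|b|/a)` in the dress of the fact: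
`β² = -1`; `χ(2r)² = 1` (as `2r = (1 + r)²` is the image of `2i = (1+i)²`, so `(2r)^{(p-1)/4} =
(1+r)^{(p-1)/2} = ±1`); and the Jacobi symbol `(2|b| / |a|) = ±1` (`gcd(2|b|, |a|) = 1` since `a`
is odd and `gcd(a, b) = 1` for `a² + b² = p`).  Hence `ε² = -1`, Matthews' right-hand side squares
to `-R = g(χ)²` (Prop. 9.10.1), and the vendored statement holds for every `(p, π)` up to a sign
`±1` — the bit that is Matthews' theorem proper. -/

section MatthewsRhs

namespace MatthewsQuartic

open Literature.NumberTheory.EllipticCurves.GaussianQuartic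

local notation "ℤ[i]" => GaussianInt

variable {p : ℕ} [hp : Fact p.Prime] {a b : ℤ}

/-- `gcd(a, b) = 1` when `a² + b² = p` is prime. [folklore] -/
theorem int_gcd_eq_one (hab : a ^ 2 + b ^ 2 = (p : ℤ)) : Int.gcd b a = 1 := by
  set d := Int.gcd b a with hd
  have hda : (d : ℤ) ∣ a := Int.gcd_dvd_right b a
  have hdb : (d : ℤ) ∣ b := Int.gcd_dvd_left b a
  have hd2 : ((d ^ 2 : ℕ) : ℤ) ∣ (p : ℤ) := by
    rw [← hab]
    push_cast
    exact dvd_add (pow_dvd_pow_of_dvd hda 2) (pow_dvd_pow_of_dvd hdb 2)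
  have hd2' : d ^ 2 ∣ p := by exact_mod_cast hd2
  have hdp : d ∣ p := dvd_trans (dvd_pow_self d two_ne_zero) hd2'
  rcases (Nat.dvd_prime hp.out).mp hdp with h1 | h1
  · exact h1
  · exfalso
    rw [h1] at hd2'
    have h2 := hp.out.two_le
    have := Nat.le_of_dvd hp.out.pos hd2'
    nlinarith

/-- `gcd(2|b|, |a|) = 1` for `a² + b² = p` prime and `a` odd (so the Jacobi symbol `(2|b|/|a|)` is
`±1`). [folklore] -/
theorem gcd_two_mul_abs_eq_one (hab : a ^ 2 + b ^ 2 = (p : ℤ)) (ha : Odd a) :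
    Int.gcd (2 * |b|) (a.natAbs : ℤ) = 1 := by
  have h1 : Nat.Coprime 2 a.natAbs := Nat.coprime_two_left.mpr (Int.natAbs_odd.mpr ha)
  have h2 : Nat.Coprime b.natAbs a.natAbs := int_gcd_eq_one hab
  have h3 : Nat.Coprime (2 * b.natAbs) a.natAbs := Nat.Coprime.mul_left h1 h2
  rw [Int.gcd, Int.natAbs_natCast, Int.natAbs_mul, Int.natAbs_abs]
  exact h3

/-- **The Jacobi symbol `(2|b| / |a|)` is `±1`.** [folklore] -/
theorem jacobiSym_two_mul_abs_sq (hab : a ^ 2 + b ^ 2 = (p : ℤ)) (ha : Odd a) :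
    ((jacobiSym (2 * |b|) a.natAbs : ℤ) : ℂ) ^ 2 = 1 := by
  rcases jacobiSym.eq_one_or_neg_one (gcd_two_mul_abs_eq_one hab ha) with h | h <;>
    rw [h] <;> norm_num

/-- **`χ(2r)² = 1`**: `2r = (1+r)²` (image of `2i = (1+i)²`), so `(2r)^{(p-1)/4} =
(1+r)^{(p-1)/2} ∈ {1, -1}` and the cascade takes the value `±1` at `2r`.
[cite: IrelandRosen1990, Ch. 9 §9, proof of Prop. 9.9.3 (`χ_π(2)² = χ_π(-1)`)] -/
theorem cascade_two_mul_r_sq (hp1 : p % 4 = 1) (hab : a ^ 2 + b ^ 2 = (p : ℤ)) :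
    (if (2 : ZMod p) * (-(a : ZMod p) * (b : ZMod p)⁻¹) = 0 then (0 : ℂ)
      else if ((2 : ZMod p) * (-(a : ZMod p) * (b : ZMod p)⁻¹)) ^ ((p - 1) / 4) = 1 then 1
      else if ((2 : ZMod p) * (-(a : ZMod p) * (b : ZMod p)⁻¹)) ^ ((p - 1) / 4) =
        -(a : ZMod p) * (b : ZMod p)⁻¹ then Complex.I
      else if ((2 : ZMod p) * (-(a : ZMod p) * (b : ZMod p)⁻¹)) ^ ((p - 1) / 4) = -1 then -1
      else -Complex.I) ^ 2 = 1 := by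
  have hπp := norm_mk (p := p) hab
  set r : ZMod p := -(a : ZMod p) * (b : ZMod p)⁻¹ with hr
  have hrr : r * r = -1 := iota_sq hπp
  obtain ⟨hr1, hrm1⟩ := iota_ne hp1 hπp
  change r ≠ 1 at hr1
  change r ≠ -1 at hrm1
  have h2 : (2 : ZMod p) ≠ 0 := two_ne_zero_of_one_mod_four hp1
  have hr0 : r ≠ 0 := by
    rintro h0; rw [h0, mul_zero] at hrr; exact one_ne_zero (neg_eq_zero.mp hrr.symm)
  have h1r : (1 + r : ZMod p) ≠ 0 := by
    intro h; apply hrm1; linear_combination h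
  have h2r : (2 : ZMod p) * r ≠ 0 := mul_ne_zero h2 hr0
  have hsq : (2 : ZMod p) * r = (1 + r) ^ 2 := by linear_combination -hrr
  -- `y = (2r)^m` satisfies `y² = (1+r)^{p-1} = 1`
  set y := ((2 : ZMod p) * r) ^ ((p - 1) / 4) with hy
  have hy2 : y * y = 1 := by
    rw [hy, hsq, ← pow_mul, ← pow_add]
    convert ZMod.pow_card_sub_one_eq_one h1r using 2
    omega
  rw [if_neg h2r]
  rcases mul_self_eq_one_iff.mp hy2 with h | h
  · rw [if_pos h]; norm_num
  · rw [if_neg (by rw [h]; intro e; apply h2; linear_combination -e),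
      if_neg (by rw [h]; exact fun e => hrm1 e.symm), if_pos h]
    norm_num

end MatthewsQuartic

/-- **The vendored statement holds up to one global sign.** With `RHS` literally the right-hand
side of `matthews1979_quarticGaussSum_sign` (`-β χ(2r) (2|b|/|a|) R^{1/2}`), Prop. 9.10.1 and
`ε² = (-β)² χ(2r)² (2|b|/|a|)² = -1` give `LHS² = -R = RHS²`, so `LHS = RHS ∨ LHS = -RHS` for every
admissible `(p, a, b)`: what remains of Matthews' theorem is exactly the exclusion of the second
alternative. [cite: IrelandRosen1990, Ch. 9 p. 138; Matthews1979Quartic, main theorem] -/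
theorem quarticGaussSum_eq_matthews_or_neg (p : ℕ) (a b : ℤ) (r : ZMod p) (χ : ZMod p → ℂ) (β : ℂ)
    (hp : p.Prime) (hp1 : p % 4 = 1) (hab : a ^ 2 + b ^ 2 = (p : ℤ))
    (hprim : (a % 4 = 1 ∧ b % 4 = 0) ∨ (a % 4 = 3 ∧ b % 4 = 2))
    (hr : r = -(a : ZMod p) * (b : ZMod p)⁻¹)
    (hχ : χ = fun x => if x = 0 then 0 else if x ^ ((p - 1) / 4) = 1 then 1
      else if x ^ ((p - 1) / 4) = r then Complex.I else if x ^ ((p - 1) / 4) = -1 then -1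
      else -Complex.I)
    (hβ : β = (if ((Nat.factorial ((p - 1) / 2) : ℕ) : ZMod p) = r then Complex.I else -Complex.I)) :
    (∑ x ∈ Finset.range p, χ (x : ZMod p) *
        Complex.exp (2 * Real.pi * Complex.I * (x : ℂ) / (p : ℂ)) =
      -β * χ (2 * r) * ((jacobiSym (2 * |b|) a.natAbs : ℤ) : ℂ) *
        ((-1 : ℂ) ^ ((p - 1) / 4) * ((a : ℂ) + (b : ℂ) * Complex.I) *
          ((Real.sqrt p : ℝ) : ℂ)) ^ ((1 : ℂ) / 2)) ∨
    (∑ x ∈ Finset.range p, χ (x : ZMod p) *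
        Complex.exp (2 * Real.pi * Complex.I * (x : ℂ) / (p : ℂ)) =
      -(-β * χ (2 * r) * ((jacobiSym (2 * |b|) a.natAbs : ℤ) : ℂ) *
        ((-1 : ℂ) ^ ((p - 1) / 4) * ((a : ℂ) + (b : ℂ) * Complex.I) *
          ((Real.sqrt p : ℝ) : ℂ)) ^ ((1 : ℂ) / 2))) := by
  haveI : Fact p.Prime := ⟨hp⟩
  have hsq := quarticGaussSum_sq p a b r χ hp hp1 hab hprim hr hχ
  have ha : Odd a := by
    rcases hprim with ⟨h, -⟩ | ⟨h, -⟩ <;> exact Int.odd_iff.mpr (by omega)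
  have hJ := MatthewsQuartic.jacobiSym_two_mul_abs_sq (p := p) hab ha
  have hχ2 : χ (2 * r) ^ 2 = 1 := by
    subst hχ hr
    exact MatthewsQuartic.cascade_two_mul_r_sq hp1 hab
  have hβ2 : β ^ 2 = -1 := by
    rw [hβ]; split_ifs <;> simp
  set R : ℂ := (-1 : ℂ) ^ ((p - 1) / 4) * ((a : ℂ) + (b : ℂ) * Complex.I) * ((Real.sqrt p : ℝ) : ℂ)
    with hR
  have hroot : (R ^ ((1 : ℂ) / 2)) ^ 2 = R := by
    rw [one_div]
    exact Complex.cpow_nat_inv_pow R two_ne_zero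
  rw [← sq_eq_sq_iff_eq_or_eq_neg, hsq, mul_pow, mul_pow, mul_pow, neg_sq, hroot, hβ2, hχ2, hJ]
  ring

end MatthewsRhs

end Literature.NumberTheory.GaussSums
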